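import Literature.NumberTheory.Sieve.ParityWave0
import HarnessLib

/-!
# Discharged fact: the Möbius form of Chowla's conjecture implies Sarnak's conjecture

`Literature.NumberTheory.Sieve.ParityWave0` records as a named fact
(`sarnakConjecture_of_moebiusChowlaConjecture`, **parity.S23**) the implication
`MoebiusChowlaConjecture → SarnakConjecture`: the sign-pattern (Möbius) form of Chowla's
conjecture implies Sarnak's Möbius disjointness conjecture (for every compact metric `X`,
continuous `T` of zero topological entropy `Dynamics.coverEntropy T univ = 0`, `f ∈ C(X, ℂ)`,
`x ∈ X`: `(1/N) ∑_{n<N} μ(n) f(Tⁿ x) → 0`). This file proves it: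
`Literature.NumberTheory.Sieve.sarnakConjecture_of_moebiusChowlaConjecture_holds`.

## Sources

* P. Sarnak, *Three lectures on the Möbius function, randomness and dynamics* (IAS lecture
  notes, 2010), §3: the implication "Chowla ⇒ Möbius disjointness" (via the ergodic
  reformulation of Chowla's conjecture).
* T. Tao, *The Chowla conjecture and the Sarnak conjecture*, What's new, 14 Oct 2012
  (`Tao2012ChowlaSarnakBlog`): the elementary counting / moment-method proof, which is the one
  formalised here.
* E. H. El Abdalaoui, J. Kułaga-Przymus, M. Lemańczyk, T. de la Rue, *The Chowla and the Sarnak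
  conjectures from ergodic theory point of view*, DCDS 37 (2017) (`AbdalaouiEtAl2017`),
  Theorem 4.10 "(Ch) implies (S)" (p. 10 of arXiv:1410.1673), with the Möbius–Chowla
  conjecture stated exactly in the vendored sign-pattern form (exponents `i_s ∈ {1,2}` not all
  `2`, distinct shifts; ibid. Introduction) and Sarnak's conjecture as vendored.

## The argument (Tao 2012), as formalised

Write `u(n) = g(Tⁿx)` with `g` real, `|g| ≤ 1` (real and imaginary parts of `f/(‖f‖+1)`).
1. `tendsto_moebius_monomial_mul_div`: Chowla in sign-pattern form gives, for ANY tuple of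
   shifts `J` (repetitions allowed) and a further shift `m ∉ J`,
   `∑_{i<N} (∏_l μ(i+J_l)) μ(i+m) = o(N)` (collect repeated shifts with `μ^e ∈ {μ, μ²}`;
   `Finset.prod_comp`, `Finset.orderEmbOfFin`).
2. `tendsto_windowSum_pow_mul_moebius_div`: hence `∑_{i<N} (∑_{j<m} c_j μ(i+j))^t μ(i+m) = o(N)`.
3. `eventually_moment_le`: by induction on `m` (binomial expansion in the last variable; odd
   powers vanish by 2., even powers are `≤ 1`) the `2q`-th moment satisfies the Rademacher
   recursion, whence `∑_{i<N} (∑_{j<m} c_j μ(i+j))^{2q} ≤ (m^q (2q)!/q! + θ) N` eventually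
   (`sum_choose_mul_evenMoment_le` is the recursion inequality
   `∑_s C(2q,2s) m^s (2s)!/s! ≤ (m+1)^q (2q)!/q!`).
4. `tendsto_moebius_avg_of_patternCover`: double counting
   (`abs_mul_sum_sub_sum_window_le`) + pattern approximation + Markov with `p = ⌊ε²m/(2e)⌋`
   and a union bound over `≤ e^{ε² m/(4e)}` patterns (`card_filter_le_sum_moment_div`,
   `exists_threshold`) give `limsup |(1/N)∑ μ(n)u(n)| ≤ 4ε`.
5. `exists_patternCover_of_coverEntropy_eq_zero`: zero `coverEntropy` ⇒ for the entourage
   `{d < δ}` (uniform continuity of `g`) the minimal `(U,m)`-dynamical covers have cardinality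
   `≤ e^{ηm}` for large `m` (`ExpGrowth.eventually_le_exp`, `Dynamics.coverMincard_finite_iff`),
   and their orbit patterns `(g(T^j y))_{j<m}` approximate every window of `u`.

## Not here

No new definitions or named facts (D-0026): everything is proved inline. The converse
direction, the logarithmic versions (Tao 2016, Tao–Teräväinen) and the ergodic proof of AKLR
§4.3 are not formalised.
-/

open Filter Asymptotics Finset
open scoped ArithmeticFunction.Moebius Topology Nat

namespace Literature.NumberTheory.Sieve

namespace SarnakOfChowla

/-- `μ(n)^e = μ(n)^2` or `μ(n)` according to the parity of `e ≥ 1`, because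
`μ(n) ∈ {-1, 0, 1}`. [folklore] -/
theorem moebius_pow_eq_pow_ite (n e : ℕ) (he : e ≠ 0) :
    (μ n) ^ e = (μ n) ^ (if Even e then 2 else 1) := by
  rcases ArithmeticFunction.moebius_eq_or n with h | h | h
  · rw [h, zero_pow he, zero_pow (by split_ifs <;> norm_num)]
  · simp [h]
  · rw [h]
    split_ifs with hev
    · rw [hev.neg_one_pow, neg_one_sq]
    · rw [(Nat.not_even_iff_odd.1 hev).neg_one_pow, pow_one]

/-- An odd power of `μ(n)` is `μ(n)`. [folklore] -/
theorem moebius_pow_odd (n e : ℕ) (he : Odd e) : (μ n) ^ e = μ n := by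
  rcases ArithmeticFunction.moebius_eq_or n with h | h | h
  · rw [h, zero_pow (Nat.pos_of_ne_zero he.pos.ne').ne']
  · simp [h]
  · rw [h, he.neg_one_pow]

/-- **General Chowla from the sign-pattern form.** If the Möbius form of Chowla's conjecture
holds, then for any tuple of shifts `J : Fin r → ℕ` (repetitions allowed) avoiding a further
shift `m`, the correlation `∑_{i<N} (∏_l μ(i + J l)) μ(i + m)` is `o(N)`: the shift `m` occurs
with exponent exactly one, so after collecting repeated shifts (`μ^e = μ` or `μ²`) the
monomial is one of the sign patterns of `MoebiusChowlaConjecture`.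
(Tao, *The Chowla conjecture and the Sarnak conjecture*, blog 2012, proof of the Proposition
"Chowla implies Sarnak", first step; Sarnak, *Three lectures* (2010), §3.)
[cite: Tao2012ChowlaSarnakBlog, proof of Proposition (Chowla implies Sarnak)] -/
theorem tendsto_moebius_monomial_mul_div (hC : MoebiusChowlaConjecture) {r : ℕ} (J : Fin r → ℕ)
    (m : ℕ) (hJ : ∀ l, J l ≠ m) :
    Tendsto (fun N : ℕ => (∑ i ∈ range N, (∏ l, (μ (i + J l) : ℝ)) * (μ (i + m) : ℝ)) / (N : ℝ))
      atTop (𝓝 0) := by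
  classical
  -- all shifts, the distinguished one first
  set g : Fin (r + 1) → ℕ := Fin.cons m J with hg_def
  set S : Finset ℕ := (univ : Finset (Fin (r + 1))).image g with hS_def
  -- multiplicity of a shift
  set e : ℕ → ℕ := fun s => #{l ∈ (univ : Finset (Fin (r + 1))) | g l = s} with he_def
  have hmS : m ∈ S := mem_image.2 ⟨0, mem_univ _, by simp [hg_def]⟩
  have hfilter : (univ.filter fun l : Fin (r + 1) => g l = m) = {0} := by
    ext l
    simp only [mem_filter, mem_univ, true_and, mem_singleton]
    refine Fin.cases ?_ (fun l' => ?_) l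
    · simp [hg_def]
    · simp only [hg_def, Fin.cons_succ, Fin.succ_ne_zero, iff_false]
      exact hJ l'
  have he_m : e m = 1 := by simp only [he_def, hfilter, card_singleton]
  set k : ℕ := #S with hk_def
  set h : Fin k → ℕ := fun t => S.orderEmbOfFin rfl t with hh_def
  set a : Fin k → ℕ := fun t => if Even (e (h t)) then 2 else 1 with ha_def
  have hh : Function.Injective h := (S.orderEmbOfFin rfl).injective
  have ha : ∀ t, a t = 1 ∨ a t = 2 := by
    intro t; simp only [ha_def]; split_ifs <;> simp
  have ha1 : ∃ t, a t = 1 := by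
    have : m ∈ Set.range (S.orderEmbOfFin rfl) := by
      rw [Finset.range_orderEmbOfFin, Finset.mem_coe]; exact hmS
    obtain ⟨t, ht⟩ := this
    refine ⟨t, ?_⟩
    have : h t = m := ht
    simp [ha_def, this, he_m]
  have key : ∀ n : ℕ, (∏ l, μ (n + J l)) * μ (n + m) = ∏ t, μ (n + h t) ^ a t := by
    intro n
    calc (∏ l, μ (n + J l)) * μ (n + m) = ∏ l : Fin (r + 1), μ (n + g l) := by
            rw [Fin.prod_univ_succ]; simp [hg_def, mul_comm]
      _ = ∏ s ∈ S, μ (n + s) ^ e s := Finset.prod_comp (fun s => μ (n + s)) g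
      _ = ∏ s ∈ S, μ (n + s) ^ (if Even (e s) then 2 else 1) := by
            refine prod_congr rfl fun s hs => moebius_pow_eq_pow_ite _ _ ?_
            obtain ⟨l, -, rfl⟩ := mem_image.1 hs
            exact card_ne_zero.2 ⟨l, by simp⟩
      _ = ∏ t, μ (n + h t) ^ a t := by
            have hmap := Finset.prod_map (univ : Finset (Fin k)) (S.orderEmbOfFin rfl).toEmbedding
              (fun s => μ (n + s) ^ (if Even (e s) then 2 else 1))
            rw [Finset.map_orderEmbOfFin_univ] at hmap
            rw [hmap]
            rfl
  have ht := (hC k h a hh ha ha1).tendsto_div_nhds_zero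
  have hfun : (fun N : ℕ => (∑ i ∈ range N, (∏ l, (μ (i + J l) : ℝ)) * (μ (i + m) : ℝ)) / (N : ℝ))
      = fun N : ℕ => (moebiusCorrelation h a N : ℝ) / (N : ℝ) := by
    funext N
    simp only [moebiusCorrelation, ← key]
    push_cast
    rfl
  rw [hfun]
  exact ht

/-- **Vanishing of odd cross moments.** Under the Möbius–Chowla conjecture, for real weights
`c_j`, `∑_{i<N} (∑_{j<m} c_j μ(i+j))^t · μ(i+m) = o(N)`: expand the power into monomials in
`μ(i+j)`, `j < m`, each multiplied by the new shift `μ(i+m)` with exponent one.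
(Tao, blog 2012, proof of the Proposition, expansion of the moment.)
[cite: Tao2012ChowlaSarnakBlog, proof of Proposition (Chowla implies Sarnak)] -/
theorem tendsto_windowSum_pow_mul_moebius_div (hC : MoebiusChowlaConjecture) (c : ℕ → ℝ)
    (m t : ℕ) :
    Tendsto (fun N : ℕ =>
      (∑ i ∈ range N, (∑ j ∈ range m, c j * (μ (i + j) : ℝ)) ^ t * (μ (i + m) : ℝ)) / (N : ℝ))
      atTop (𝓝 0) := by
  classical
  set P : Finset (Fin t → ℕ) := Fintype.piFinset fun _ : Fin t => range m with hP
  have expand : ∀ i : ℕ, (∑ j ∈ range m, c j * (μ (i + j) : ℝ)) ^ t * (μ (i + m) : ℝ)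
      = ∑ J ∈ P, (∏ l, c (J l)) * ((∏ l, (μ (i + J l) : ℝ)) * (μ (i + m) : ℝ)) := by
    intro i
    rw [Finset.sum_pow', Finset.sum_mul]
    refine sum_congr rfl fun J _ => ?_
    rw [prod_mul_distrib]; ring
  have hrw : ∀ N : ℕ,
      (∑ i ∈ range N, (∑ j ∈ range m, c j * (μ (i + j) : ℝ)) ^ t * (μ (i + m) : ℝ)) / (N : ℝ)
        = ∑ J ∈ P, (∏ l, c (J l)) *
            ((∑ i ∈ range N, (∏ l, (μ (i + J l) : ℝ)) * (μ (i + m) : ℝ)) / (N : ℝ)) := by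
    intro N
    simp_rw [expand]
    rw [Finset.sum_comm, Finset.sum_div]
    refine sum_congr rfl fun J _ => ?_
    rw [← Finset.mul_sum, mul_div_assoc]
  simp_rw [hrw]
  have hlim := tendsto_finsetSum P fun J hJ =>
    (tendsto_moebius_monomial_mul_div hC J m (fun l => by
      have h' := hJ
      simp only [hP, Fintype.mem_piFinset, mem_range] at h'
      exact (h' l).ne)).const_mul (∏ l, c (J l))
  simpa using hlim


/-! ### Even moments of the window sums -/

/-- Parity split of a sum over `range (2q+1)`. [folklore] -/
theorem sum_range_two_mul_succ (f : ℕ → ℝ) (q : ℕ) :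
    ∑ r ∈ range (2 * q + 1), f r
      = ∑ s ∈ range (q + 1), f (2 * s) + ∑ s ∈ range q, f (2 * s + 1) := by
  induction q with
  | zero => simp
  | succ q ih =>
    have h1 : 2 * (q + 1) + 1 = (2 * q + 1) + 1 + 1 := by ring
    rw [h1, sum_range_succ, sum_range_succ, ih]
    simp only [sum_range_succ]
    ring_nf

/-- The binomial–factorial inequality behind the Rademacher moment recursion:
`C(2q,2s) (2s)! q! ≤ C(q,s) (2q)! s!`, i.e. `C(2q,2s)·(2s)!/s! ≤ C(q,s)·(2q)!/q!`,
equivalent to `(q-s)! ≤ (2q-2s)!`. [folklore] -/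
theorem choose_two_mul_factorial_le (q s : ℕ) (hs : s ≤ q) :
    (2 * q).choose (2 * s) * (2 * s)! * q ! ≤ q.choose s * (2 * q)! * s ! := by
  have h1 := Nat.choose_mul_factorial_mul_factorial (show 2 * s ≤ 2 * q by omega)
  have h2 := Nat.choose_mul_factorial_mul_factorial hs
  have h3 : (q - s)! ≤ (2 * q - 2 * s)! := Nat.factorial_le (by omega)
  have hpos : 0 < (q - s)! * (2 * q - 2 * s)! := by positivity
  refine Nat.le_of_mul_le_mul_right ?_ hpos
  calc (2 * q).choose (2 * s) * (2 * s)! * q ! * ((q - s)! * (2 * q - 2 * s)!)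
        = ((2 * q).choose (2 * s) * (2 * s)! * (2 * q - 2 * s)!) * q ! * (q - s)! := by ring
    _ = (2 * q)! * q ! * (q - s)! := by rw [h1]
    _ ≤ (2 * q)! * q ! * (2 * q - 2 * s)! := Nat.mul_le_mul_left _ h3
    _ = (2 * q)! * (q.choose s * s ! * (q - s)!) * (2 * q - 2 * s)! := by rw [h2]
    _ = q.choose s * (2 * q)! * s ! * ((q - s)! * (2 * q - 2 * s)!) := by ring

/-- Real form of `choose_two_mul_factorial_le`: `C(2q,2s)·(2s)!/s! ≤ C(q,s)·(2q)!/q!`.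
[folklore] -/
theorem choose_two_mul_mul_div_le (q s : ℕ) (hs : s ≤ q) :
    ((2 * q).choose (2 * s) : ℝ) * (((2 * s)! : ℝ) / s !)
      ≤ (q.choose s : ℝ) * (((2 * q)! : ℝ) / q !) := by
  have key : ((2 * q).choose (2 * s) : ℝ) * (2 * s)! * q ! ≤ (q.choose s : ℝ) * (2 * q)! * s ! := by
    exact_mod_cast choose_two_mul_factorial_le q s hs
  have hs0 : (0 : ℝ) < s ! := by positivity
  have hq0 : (0 : ℝ) < q ! := by positivity
  calc ((2 * q).choose (2 * s) : ℝ) * (((2 * s)! : ℝ) / s !)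
        = ((2 * q).choose (2 * s) : ℝ) * (2 * s)! * q ! / (s ! * q !) := by field_simp
    _ ≤ (q.choose s : ℝ) * (2 * q)! * s ! / (s ! * q !) := by gcongr
    _ = (q.choose s : ℝ) * (((2 * q)! : ℝ) / q !) := by field_simp

/-- The recursion inequality `∑_{s ≤ q} C(2q,2s) m^s (2s)!/s! ≤ (m+1)^q (2q)!/q!`, written as a
sum over all `r ≤ 2q` with the odd terms set to zero. [folklore] -/
theorem sum_choose_mul_evenMoment_le (m q : ℕ) :
    ∑ r ∈ range (2 * q + 1), ((2 * q).choose r : ℝ) *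
        (if Even r then (m : ℝ) ^ (r / 2) * ((r ! : ℝ) / (r / 2)!) else 0)
      ≤ ((m : ℝ) + 1) ^ q * (((2 * q)! : ℝ) / q !) := by
  rw [sum_range_two_mul_succ]
  have h2 : ∀ s : ℕ, 2 * s / 2 = s := fun s => by omega
  have hodd : ∑ s ∈ range q, ((2 * q).choose (2 * s + 1) : ℝ) *
      (if Even (2 * s + 1) then (m : ℝ) ^ ((2 * s + 1) / 2) * (((2 * s + 1)! : ℝ) / ((2 * s + 1) / 2)!)
        else 0) = 0 := by
    refine sum_eq_zero fun s _ => ?_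
    rw [if_neg (Nat.not_even_two_mul_add_one s), mul_zero]
  rw [hodd, add_zero]
  calc ∑ s ∈ range (q + 1), ((2 * q).choose (2 * s) : ℝ) *
        (if Even (2 * s) then (m : ℝ) ^ (2 * s / 2) * (((2 * s)! : ℝ) / (2 * s / 2)!) else 0)
        = ∑ s ∈ range (q + 1), ((2 * q).choose (2 * s) : ℝ) * (((2 * s)! : ℝ) / s !) * (m : ℝ) ^ s := by
          refine sum_congr rfl fun s _ => ?_
          rw [if_pos (even_two_mul s), h2]; ring
    _ ≤ ∑ s ∈ range (q + 1), (q.choose s : ℝ) * (((2 * q)! : ℝ) / q !) * (m : ℝ) ^ s := by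
          refine sum_le_sum fun s hs => ?_
          have hsq : s ≤ q := Nat.lt_succ_iff.1 (mem_range.1 hs)
          exact mul_le_mul_of_nonneg_right (choose_two_mul_mul_div_le q s hsq) (by positivity)
    _ = ((m : ℝ) + 1) ^ q * (((2 * q)! : ℝ) / q !) := by
          rw [add_pow, sum_mul]
          refine sum_congr rfl fun s _ => ?_
          rw [one_pow]; ring

/-- **Even-moment bound (Rademacher recursion).** Under the Möbius–Chowla conjecture, for
weights `|c_j| ≤ 1` the `2q`-th moment of the window sum `∑_{j<m} c_j μ(i+j)` over `i < N` is
asymptotically at most `m^q (2q)!/q! ≤ (2qm)^q`: expanding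
`(S_m + c_m μ(·+m))^{2q}` binomially, odd powers of the new variable have vanishing average
(`tendsto_windowSum_pow_mul_moebius_div`) and even powers are at most `1`, which gives the
recursion of the moments of a Rademacher sum. (Tao, blog 2012, proof of the Proposition: the
moment computation.) [cite: Tao2012ChowlaSarnakBlog, proof of Proposition (Chowla implies Sarnak)] -/
theorem eventually_moment_le (hC : MoebiusChowlaConjecture) (c : ℕ → ℝ) (hc : ∀ j, |c j| ≤ 1)
    (m : ℕ) :
    ∀ (q : ℕ) (θ : ℝ), 0 < θ → ∀ᶠ N : ℕ in atTop,
      ∑ i ∈ range N, (∑ j ∈ range m, c j * (μ (i + j) : ℝ)) ^ (2 * q)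
        ≤ ((m : ℝ) ^ q * (((2 * q)! : ℝ) / q !) + θ) * N := by
  induction m with
  | zero =>
    intro q θ hθ
    refine Eventually.of_forall fun N => ?_
    have hN : (0 : ℝ) ≤ N := N.cast_nonneg
    rcases Nat.eq_zero_or_pos q with rfl | hq
    · simp only [sum_range_zero, mul_zero, pow_zero, Nat.factorial_zero, Nat.cast_one, div_one,
        sum_const, card_range, nsmul_eq_mul, mul_one, CharP.cast_eq_zero]
      nlinarith
    · simp only [sum_range_zero, zero_pow (by omega : 2 * q ≠ 0), sum_const_zero, CharP.cast_eq_zero,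
        zero_pow hq.ne', zero_mul, zero_add]
      positivity
  | succ m ih =>
    intro q θ hθ
    set S : ℕ → ℝ := fun i => ∑ j ∈ range m, c j * (μ (i + j) : ℝ) with hS
    set Y : ℕ → ℝ := fun i => c m * (μ (i + m) : ℝ) with hY
    have hsplit : ∀ i : ℕ, ∑ j ∈ range (m + 1), c j * (μ (i + j) : ℝ) = S i + Y i := fun i => by
      simp only [hS, hY, sum_range_succ]
    have hY1 : ∀ i, |Y i| ≤ 1 := fun i => by
      simp only [hY]
      rw [abs_mul]
      exact mul_le_one₀ (hc m) (abs_nonneg _) (mod_cast ArithmeticFunction.abs_moebius_le_one)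
    set θ' : ℝ := θ / (2 * 4 ^ q) with hθ'
    have hθ'pos : 0 < θ' := by positivity
    set E : ℕ → ℝ := fun r => if Even r then (m : ℝ) ^ (r / 2) * ((r ! : ℝ) / (r / 2)!) else 0
      with hE
    have per_r : ∀ r ∈ range (2 * q + 1), ∀ᶠ N : ℕ in atTop,
        ∑ i ∈ range N, S i ^ r * Y i ^ (2 * q - r) ≤ (E r + θ') * N := by
      intro r hr
      rcases Nat.even_or_odd r with ⟨s, rfl⟩ | hodd
      · have hs2 : (s + s) / 2 = s := by omega
        have hev : Even (s + s) := ⟨s, rfl⟩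
        have hEr : E (s + s) = (m : ℝ) ^ s * (((2 * s)! : ℝ) / s !) := by
          simp only [hE, hev, if_true, hs2, two_mul]
        filter_upwards [ih s θ' hθ'pos] with N hN
        calc ∑ i ∈ range N, S i ^ (s + s) * Y i ^ (2 * q - (s + s))
              ≤ ∑ i ∈ range N, S i ^ (2 * s) := by
                refine sum_le_sum fun i _ => ?_
                have h0 : 0 ≤ S i ^ (s + s) := Even.pow_nonneg hev _
                have h1 : Y i ^ (2 * q - (s + s)) ≤ 1 := by
                  have : 2 * q - (s + s) = 2 * (q - s) := by omega
                  rw [this, pow_mul]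
                  exact pow_le_one₀ (sq_nonneg _) ((sq_le_one_iff_abs_le_one _).2 (hY1 i))
                calc S i ^ (s + s) * Y i ^ (2 * q - (s + s))
                      ≤ S i ^ (s + s) := mul_le_of_le_one_right h0 h1
                  _ = S i ^ (2 * s) := by rw [two_mul]
          _ ≤ ((m : ℝ) ^ s * (((2 * s)! : ℝ) / s !) + θ') * N := hN
          _ = (E (s + s) + θ') * N := by rw [hEr]
      · have hodd' : Odd (2 * q - r) := by
          rcases hodd with ⟨t, rfl⟩
          have : 2 * t + 1 ≤ 2 * q := Nat.lt_succ_iff.1 (mem_range.1 hr)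
          exact ⟨q - t - 1, by omega⟩
        have hEr : E r = 0 := by simp only [hE, if_neg (Nat.not_even_iff_odd.2 hodd)]
        have hv := tendsto_windowSum_pow_mul_moebius_div hC c m r
        have hev := Metric.tendsto_nhds.1 hv θ' hθ'pos
        filter_upwards [hev] with N hN
        rw [Real.dist_0_eq_abs] at hN
        have hYpow : ∀ i, Y i ^ (2 * q - r) = c m ^ (2 * q - r) * (μ (i + m) : ℝ) := by
          intro i
          simp only [hY]
          rw [mul_pow]
          congr 1
          exact_mod_cast moebius_pow_odd (i + m) _ hodd'
        have hsum : ∑ i ∈ range N, S i ^ r * Y i ^ (2 * q - r)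
            = c m ^ (2 * q - r) * ∑ i ∈ range N, S i ^ r * (μ (i + m) : ℝ) := by
          rw [mul_sum]
          refine sum_congr rfl fun i _ => ?_
          rw [hYpow]; ring
        rw [hsum, hEr, zero_add]
        rcases Nat.eq_zero_or_pos N with rfl | hNpos
        · simp
        have hNr : (0 : ℝ) < N := by exact_mod_cast hNpos
        have habs : |∑ i ∈ range N, S i ^ r * (μ (i + m) : ℝ)| ≤ θ' * N := by
          rw [abs_div, abs_of_pos hNr, div_lt_iff₀ hNr] at hN
          exact hN.le
        have hcm : |c m ^ (2 * q - r)| ≤ 1 := by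
          rw [abs_pow]; exact pow_le_one₀ (abs_nonneg _) (hc m)
        calc c m ^ (2 * q - r) * ∑ i ∈ range N, S i ^ r * (μ (i + m) : ℝ)
              ≤ |c m ^ (2 * q - r) * ∑ i ∈ range N, S i ^ r * (μ (i + m) : ℝ)| := le_abs_self _
          _ = |c m ^ (2 * q - r)| * |∑ i ∈ range N, S i ^ r * (μ (i + m) : ℝ)| := abs_mul _ _
          _ ≤ 1 * (θ' * N) := mul_le_mul hcm habs (abs_nonneg _) zero_le_one
          _ = θ' * N := one_mul _
    have hall : ∀ᶠ N : ℕ in atTop, ∀ r ∈ range (2 * q + 1),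
        ∑ i ∈ range N, S i ^ r * Y i ^ (2 * q - r) ≤ (E r + θ') * N :=
      (Finset.eventually_all (range (2 * q + 1))).2 per_r
    filter_upwards [hall] with N hN
    have hchoose : ∑ r ∈ range (2 * q + 1), ((2 * q).choose r : ℝ) = 4 ^ q := by
      have := Nat.sum_range_choose (2 * q)
      rw [pow_mul, show (2 : ℕ) ^ 2 = 4 by norm_num] at this
      exact_mod_cast this
    calc ∑ i ∈ range N, (∑ j ∈ range (m + 1), c j * (μ (i + j) : ℝ)) ^ (2 * q)
          = ∑ i ∈ range N, ∑ r ∈ range (2 * q + 1),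
              S i ^ r * Y i ^ (2 * q - r) * ((2 * q).choose r : ℝ) := by
            refine sum_congr rfl fun i _ => ?_
            rw [hsplit, add_pow]
        _ = ∑ r ∈ range (2 * q + 1), ((2 * q).choose r : ℝ) *
              ∑ i ∈ range N, S i ^ r * Y i ^ (2 * q - r) := by
            rw [sum_comm]
            refine sum_congr rfl fun r _ => ?_
            rw [mul_sum]
            refine sum_congr rfl fun i _ => ?_
            ring
        _ ≤ ∑ r ∈ range (2 * q + 1), ((2 * q).choose r : ℝ) * ((E r + θ') * N) := by
            refine sum_le_sum fun r hr => ?_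
            exact mul_le_mul_of_nonneg_left (hN r hr) (by positivity)
        _ = (∑ r ∈ range (2 * q + 1), ((2 * q).choose r : ℝ) * E r) * N
              + θ' * (∑ r ∈ range (2 * q + 1), ((2 * q).choose r : ℝ)) * N := by
            rw [sum_mul, mul_sum, sum_mul, ← sum_add_distrib]
            refine sum_congr rfl fun r _ => ?_
            ring
        _ ≤ (((m : ℝ) + 1) ^ q * (((2 * q)! : ℝ) / q !)) * N + θ' * 4 ^ q * N := by
            rw [hchoose]
            gcongr
            exact sum_choose_mul_evenMoment_le m q
        _ = (((m + 1 : ℕ) : ℝ) ^ q * (((2 * q)! : ℝ) / q !) + θ / 2) * N := by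
            rw [hθ']
            push_cast
            field_simp
        _ ≤ (((m + 1 : ℕ) : ℝ) ^ q * (((2 * q)! : ℝ) / q !) + θ) * N := by
            have hN0 : (0 : ℝ) ≤ N := N.cast_nonneg
            gcongr
            linarith


/-! ### Markov's inequality, double counting, and the core estimate -/

/-- **Markov + union bound.** If every `i` with `Q i` has some pattern `k ∈ P` with
`a < |F k i|`, then `#{i < N | Q i} ≤ ∑_{k ∈ P} ∑_{i<N} F k i^{2p} / a^{2p}`. [folklore] -/
theorem card_filter_le_sum_moment_div {ι : Type*} (P : Finset ι) (F : ι → ℕ → ℝ) (N p : ℕ)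
    {a : ℝ} (ha : 0 < a) (Q : ℕ → Prop) [DecidablePred Q]
    (hQ : ∀ i, Q i → ∃ k ∈ P, a < |F k i|) :
    (#{i ∈ range N | Q i} : ℝ) ≤ ∑ k ∈ P, (∑ i ∈ range N, F k i ^ (2 * p)) / a ^ (2 * p) := by
  classical
  have hsub : {i ∈ range N | Q i} ⊆ P.biUnion fun k => {i ∈ range N | a < |F k i|} := by
    intro i hi
    obtain ⟨hiN, hQi⟩ := mem_filter.1 hi
    obtain ⟨k, hk, hki⟩ := hQ i hQi
    exact mem_biUnion.2 ⟨k, hk, mem_filter.2 ⟨hiN, hki⟩⟩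
  calc (#{i ∈ range N | Q i} : ℝ)
        ≤ #(P.biUnion fun k => {i ∈ range N | a < |F k i|}) := by exact_mod_cast card_le_card hsub
    _ ≤ ∑ k ∈ P, (#{i ∈ range N | a < |F k i|} : ℝ) := by exact_mod_cast card_biUnion_le
    _ ≤ ∑ k ∈ P, (∑ i ∈ range N, F k i ^ (2 * p)) / a ^ (2 * p) := by
        refine sum_le_sum fun k _ => ?_
        rw [le_div_iff₀ (pow_pos ha _)]
        calc (#{i ∈ range N | a < |F k i|} : ℝ) * a ^ (2 * p)
              = ∑ i ∈ {i ∈ range N | a < |F k i|}, a ^ (2 * p) := by rw [sum_const, nsmul_eq_mul]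
          _ ≤ ∑ i ∈ {i ∈ range N | a < |F k i|}, F k i ^ (2 * p) := by
                refine sum_le_sum fun i hi => ?_
                have hai : a < |F k i| := (mem_filter.1 hi).2
                calc a ^ (2 * p) ≤ |F k i| ^ (2 * p) := pow_le_pow_left₀ ha.le hai.le _
                  _ = F k i ^ (2 * p) := Even.pow_abs (even_two_mul p) _
          _ ≤ ∑ i ∈ range N, F k i ^ (2 * p) :=
                sum_le_sum_of_subset_of_nonneg (filter_subset _ _)
                  fun i _ _ => Even.pow_nonneg (even_two_mul p) _

/-- **Double counting.** For `|a n| ≤ 1`,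
`|m ∑_{n<N} a n - ∑_{i<N} ∑_{j<m} a (i+j)| ≤ 2m²`. [folklore] -/
theorem abs_mul_sum_sub_sum_window_le (a : ℕ → ℝ) (ha : ∀ n, |a n| ≤ 1) (m N : ℕ) :
    |(m : ℝ) * ∑ n ∈ range N, a n - ∑ i ∈ range N, ∑ j ∈ range m, a (i + j)|
      ≤ 2 * (m : ℝ) ^ 2 := by
  have hA : ∀ t₁ t₂ : ℕ, |∑ n ∈ range (t₁ + t₂), a n - ∑ n ∈ range t₁, a n| ≤ t₂ := by
    intro t₁ t₂
    rw [sum_range_add, add_sub_cancel_left]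
    calc |∑ x ∈ range t₂, a (t₁ + x)| ≤ ∑ x ∈ range t₂, |a (t₁ + x)| := abs_sum_le_sum_abs _ _
      _ ≤ ∑ x ∈ range t₂, (1 : ℝ) := sum_le_sum fun x _ => ha _
      _ = t₂ := by simp
  have hswap : ∑ i ∈ range N, ∑ j ∈ range m, a (i + j)
      = ∑ j ∈ range m, (∑ n ∈ range (j + N), a n - ∑ n ∈ range j, a n) := by
    rw [sum_comm]
    refine sum_congr rfl fun j _ => ?_
    rw [sum_range_add, add_sub_cancel_left]
    exact sum_congr rfl fun i _ => by rw [add_comm]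
  have hm : (m : ℝ) * ∑ n ∈ range N, a n = ∑ j ∈ range m, ∑ n ∈ range N, a n := by
    rw [sum_const, card_range, nsmul_eq_mul]
  rw [hswap, hm, ← sum_sub_distrib]
  calc |∑ j ∈ range m, (∑ n ∈ range N, a n - (∑ n ∈ range (j + N), a n - ∑ n ∈ range j, a n))|
        ≤ ∑ j ∈ range m, |∑ n ∈ range N, a n - (∑ n ∈ range (j + N), a n - ∑ n ∈ range j, a n)| :=
          abs_sum_le_sum_abs _ _
    _ ≤ ∑ j ∈ range m, (2 * m : ℝ) := by
          refine sum_le_sum fun j hj => ?_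
          have hj' : (j : ℝ) ≤ m := by exact_mod_cast (mem_range.1 hj).le
          have h1 : |∑ n ∈ range (N + j), a n - ∑ n ∈ range N, a n| ≤ j := hA N j
          have h2 : |∑ n ∈ range j, a n| ≤ j := by simpa using hA 0 j
          have h3 : ∑ n ∈ range N, a n - (∑ n ∈ range (j + N), a n - ∑ n ∈ range j, a n)
              = ∑ n ∈ range j, a n - (∑ n ∈ range (N + j), a n - ∑ n ∈ range N, a n) := by
            rw [add_comm j N]; ring
          rw [h3]
          calc |∑ n ∈ range j, a n - (∑ n ∈ range (N + j), a n - ∑ n ∈ range N, a n)|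
                ≤ |∑ n ∈ range j, a n| + |∑ n ∈ range (N + j), a n - ∑ n ∈ range N, a n| :=
                  abs_sub _ _
            _ ≤ j + j := add_le_add h2 h1
            _ ≤ 2 * m := by linarith
    _ = 2 * (m : ℝ) ^ 2 := by rw [sum_const, card_range, nsmul_eq_mul]; ring

/-- A window sum of `μ · u` is within `ε m` of the window sum against an `ε`-close pattern.
[folklore] -/
theorem abs_windowSum_le_of_approx (u c : ℕ → ℝ) (m i : ℕ) {ε : ℝ}
    (happrox : ∀ j < m, |u (i + j) - c j| ≤ ε) :
    |∑ j ∈ range m, (μ (i + j) : ℝ) * u (i + j)|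
      ≤ |∑ j ∈ range m, c j * (μ (i + j) : ℝ)| + ε * m := by
  have hsplit : ∑ j ∈ range m, (μ (i + j) : ℝ) * u (i + j)
      = ∑ j ∈ range m, c j * (μ (i + j) : ℝ) + ∑ j ∈ range m, (μ (i + j) : ℝ) * (u (i + j) - c j) := by
    rw [← sum_add_distrib]
    exact sum_congr rfl fun j _ => by ring
  rw [hsplit]
  refine (abs_add_le _ _).trans ?_
  gcongr
  calc |∑ j ∈ range m, (μ (i + j) : ℝ) * (u (i + j) - c j)|
        ≤ ∑ j ∈ range m, |(μ (i + j) : ℝ) * (u (i + j) - c j)| := abs_sum_le_sum_abs _ _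
    _ ≤ ∑ j ∈ range m, ε := by
        refine sum_le_sum fun j hj => ?_
        rw [abs_mul]
        calc |(μ (i + j) : ℝ)| * |u (i + j) - c j| ≤ 1 * ε :=
              mul_le_mul (mod_cast ArithmeticFunction.abs_moebius_le_one) (happrox j (mem_range.1 hj)) (abs_nonneg _)
                zero_le_one
          _ = ε := one_mul ε
    _ = ε * m := by rw [sum_const, card_range, nsmul_eq_mul, mul_comm]

/-- Trivial bound: a window sum of `μ · u`, `|u| ≤ 1`, over `m` terms is at most `m`.
[folklore] -/
theorem abs_windowSum_le_length (u : ℕ → ℝ) (hu : ∀ n, |u n| ≤ 1) (m i : ℕ) :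
    |∑ j ∈ range m, (μ (i + j) : ℝ) * u (i + j)| ≤ m := by
  calc |∑ j ∈ range m, (μ (i + j) : ℝ) * u (i + j)|
        ≤ ∑ j ∈ range m, |(μ (i + j) : ℝ) * u (i + j)| := abs_sum_le_sum_abs _ _
    _ ≤ ∑ j ∈ range m, (1 : ℝ) := by
        refine sum_le_sum fun j _ => ?_
        rw [abs_mul]
        exact mul_le_one₀ (mod_cast ArithmeticFunction.abs_moebius_le_one) (abs_nonneg _) (hu _)
    _ = m := by simp

/-- **Choice of parameters.** With `η = ε²/(4e)` and `p = ⌊ε² m/(2e)⌋`, the union bound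
`K · (m^p (2p)!/p! + 1)/(ε m)^{2p}` over `K ≤ e^{η m}` patterns is at most
`2e · exp(-ε² m/(4e)) ≤ ε` for `m` large: `(2p)!/p! ≤ (2p)^p`, `(2pm)^p/(εm)^{2p} = (2p/(ε²m))^p
≤ e^{-p}`. (Tao, blog 2012, proof of the Proposition: `p` a small multiple of `ε² m`.)
[cite: Tao2012ChowlaSarnakBlog, proof of Proposition (Chowla implies Sarnak)] -/
theorem exists_threshold {ε : ℝ} (hε : 0 < ε) :
    ∃ m₀ : ℕ, ∀ m : ℕ, m₀ ≤ m → ∀ p : ℕ, (p : ℝ) ≤ ε ^ 2 * m / (2 * Real.exp 1) →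
      ε ^ 2 * m / (2 * Real.exp 1) < p + 1 →
      ∀ K : ℕ, (K : ℝ) ≤ Real.exp (ε ^ 2 / (4 * Real.exp 1) * m) →
      (K : ℝ) * ((m : ℝ) ^ p * (((2 * p)! : ℝ) / p !) + 1) / (ε * m) ^ (2 * p) ≤ ε := by
  have he : 0 < Real.exp 1 := Real.exp_pos 1
  set a : ℝ := ε ^ 2 with ha
  have ha0 : 0 < a := by positivity
  -- the final quantity tends to zero
  have hg : Tendsto (fun m : ℕ => a / (4 * Real.exp 1) * (m : ℝ)) atTop atTop :=
    (tendsto_natCast_atTop_atTop (R := ℝ)).const_mul_atTop (by positivity)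
  have hlim : Tendsto (fun m : ℕ => 2 * Real.exp 1 * Real.exp (-(a / (4 * Real.exp 1) * (m : ℝ))))
      atTop (𝓝 0) := by
    have := (Real.tendsto_exp_neg_atTop_nhds_zero.comp hg).const_mul (2 * Real.exp 1)
    simpa using this
  obtain ⟨m₀, hm₀⟩ := eventually_atTop.1 ((hlim.eventually_lt_const hε).and (eventually_ge_atTop 1))
  refine ⟨m₀, fun m hm p hp1 hp2 K hK => ?_⟩
  obtain ⟨hsmall, hm1⟩ := hm₀ m hm
  have hmr : (1 : ℝ) ≤ m := by exact_mod_cast hm1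
  -- (2p)!/p! ≤ (2p)^p
  have hfac : ((2 * p)! : ℝ) / p ! ≤ (2 * p : ℝ) ^ p := by
    rw [div_le_iff₀ (by positivity)]
    have h1 : p ! * (p + 1).ascFactorial p = (p + p)! := Nat.factorial_mul_ascFactorial p p
    have h2 : (p + 1).ascFactorial p ≤ (p + p) ^ p := Nat.ascFactorial_le_pow_add p p
    have h3 : (2 * p)! ≤ (2 * p) ^ p * p ! := by
      rw [two_mul, ← h1, mul_comm]
      exact Nat.mul_le_mul_right _ h2
    exact_mod_cast h3
  -- numerator
  have hnum : (m : ℝ) ^ p * (((2 * p)! : ℝ) / p !) + 1 ≤ 2 * ((2 * p : ℝ) * m) ^ p := by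
    have h1 : (m : ℝ) ^ p * (((2 * p)! : ℝ) / p !) ≤ ((2 * p : ℝ) * m) ^ p := by
      rw [mul_pow, mul_comm]
      exact mul_le_mul_of_nonneg_right hfac (by positivity)
    have h2 : (1 : ℝ) ≤ ((2 * p : ℝ) * m) ^ p := by
      rcases Nat.eq_zero_or_pos p with rfl | hp
      · simp
      · refine one_le_pow₀ ?_
        have : (1 : ℝ) ≤ p := by exact_mod_cast hp
        nlinarith
    linarith
  -- the ratio
  have hratio : ((2 * p : ℝ) * m) ^ p / (ε * m) ^ (2 * p) = (2 * p / (a * m)) ^ p := by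
    rw [ha, pow_mul, ← div_pow]
    congr 1
    field_simp
  have hx : 2 * p / (a * m) ≤ Real.exp (-1) := by
    rw [div_le_iff₀ (by positivity), Real.exp_neg]
    rw [le_div_iff₀ (by positivity)] at hp1
    calc (2 * p : ℝ) = (Real.exp 1)⁻¹ * (p * (2 * Real.exp 1)) := by
          rw [inv_mul_eq_div, eq_div_iff he.ne']; ring
      _ ≤ (Real.exp 1)⁻¹ * (a * m) := mul_le_mul_of_nonneg_left hp1 (inv_nonneg.2 he.le)
  have hx0 : 0 ≤ 2 * p / (a * m) := by positivity
  have hpow : (2 * p / (a * m)) ^ p ≤ Real.exp (-(p : ℝ)) := by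
    calc (2 * p / (a * m)) ^ p ≤ (Real.exp (-1)) ^ p := pow_le_pow_left₀ hx0 hx p
      _ = Real.exp (-(p : ℝ)) := by rw [← Real.exp_nat_mul]; ring_nf
  have hexp : Real.exp (-(p : ℝ)) ≤ Real.exp (1 - a * m / (2 * Real.exp 1)) :=
    Real.exp_le_exp.2 (by linarith [hp2])
  have hK0 : (0 : ℝ) ≤ K := K.cast_nonneg
  calc (K : ℝ) * ((m : ℝ) ^ p * (((2 * p)! : ℝ) / p !) + 1) / (ε * m) ^ (2 * p)
      ≤ Real.exp (a / (4 * Real.exp 1) * m) * (2 * ((2 * p : ℝ) * m) ^ p) / (ε * m) ^ (2 * p) := by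
        gcongr
    _ = 2 * Real.exp (a / (4 * Real.exp 1) * m) * (((2 * p : ℝ) * m) ^ p / (ε * m) ^ (2 * p)) := by
        ring
    _ ≤ 2 * Real.exp (a / (4 * Real.exp 1) * m) * Real.exp (1 - a * m / (2 * Real.exp 1)) := by
        rw [hratio]
        gcongr
        exact hpow.trans hexp
    _ = 2 * Real.exp 1 * Real.exp (-(a / (4 * Real.exp 1) * (m : ℝ))) := by
        rw [mul_assoc, ← Real.exp_add, mul_assoc, ← Real.exp_add]
        congr 2
        field_simp
        ring
    _ ≤ ε := hsmall.le

/-- **Core estimate (Tao's argument).** Assume the Möbius–Chowla conjecture. Let `u` be a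
real sequence with `|u| ≤ 1` whose length-`m` windows `(u(i+j))_{j<m}` can, for every
`ε, η > 0` and arbitrarily large `m`, be `ε`-approximated in sup norm by at most `e^{η m}`
patterns ("zero sequence entropy"). Then `(1/N) ∑_{n<N} μ(n) u(n) → 0`.
Proof: double counting reduces to window sums; windows are replaced by their patterns; a
window whose pattern correlates with `μ` above `ε m` is "bad", and by Markov's inequality with
the `2p`-th moment bound plus a union bound over the `e^{ηm}` patterns the bad windows have
density `≤ ε`. (Tao, *The Chowla conjecture and the Sarnak conjecture*, blog 2012, proof of the
Proposition "Chowla implies Sarnak"; Sarnak 2010, §3.)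
[cite: Tao2012ChowlaSarnakBlog, Proposition (Chowla implies Sarnak)] -/
theorem tendsto_moebius_avg_of_patternCover (hC : MoebiusChowlaConjecture) (u : ℕ → ℝ)
    (hu : ∀ n, |u n| ≤ 1)
    (hcover : ∀ ε : ℝ, 0 < ε → ∀ η : ℝ, 0 < η → ∀ m₀ : ℕ, ∃ m : ℕ, m₀ ≤ m ∧
      ∃ P : Finset (ℕ → ℝ), (#P : ℝ) ≤ Real.exp (η * m) ∧ (∀ c ∈ P, ∀ j, |c j| ≤ 1) ∧
        ∀ i : ℕ, ∃ c ∈ P, ∀ j < m, |u (i + j) - c j| ≤ ε) :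
    Tendsto (fun N : ℕ => (∑ n ∈ range N, (μ n : ℝ) * u n) / (N : ℝ)) atTop (𝓝 0) := by
  classical
  rw [Metric.tendsto_nhds]
  intro ε₀ hε₀
  obtain ⟨ε, hε, hεε₀⟩ : ∃ ε : ℝ, 0 < ε ∧ 8 * ε ≤ ε₀ := ⟨ε₀ / 8, by positivity, by linarith⟩
  obtain ⟨m₀, hm₀⟩ := exists_threshold hε
  obtain ⟨m, hm, P, hP, hc, hcov⟩ :=
    hcover ε hε (ε ^ 2 / (4 * Real.exp 1)) (by positivity) (max m₀ 1)
  have hm1 : 1 ≤ m := le_of_max_le_right hm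
  have hmr : (0 : ℝ) < m := by exact_mod_cast hm1
  set p : ℕ := ⌊ε ^ 2 * m / (2 * Real.exp 1)⌋₊ with hp
  have hp1 : (p : ℝ) ≤ ε ^ 2 * m / (2 * Real.exp 1) := Nat.floor_le (by positivity)
  have hp2 : ε ^ 2 * m / (2 * Real.exp 1) < p + 1 := Nat.lt_floor_add_one _
  have hnum := hm₀ m (le_of_max_le_left hm) p hp1 hp2 #P hP
  -- eventual inputs
  have hmom : ∀ᶠ N : ℕ in atTop, ∀ c ∈ P,
      ∑ i ∈ range N, (∑ j ∈ range m, c j * (μ (i + j) : ℝ)) ^ (2 * p)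
        ≤ ((m : ℝ) ^ p * (((2 * p)! : ℝ) / p !) + 1) * N :=
    (Finset.eventually_all P).2 fun c hcP => eventually_moment_le hC c (hc c hcP) m p 1 one_pos
  have hlarge : ∀ᶠ N : ℕ in atTop, (2 * m : ℝ) ≤ ε * N :=
    ((tendsto_natCast_atTop_atTop (R := ℝ)).const_mul_atTop hε).eventually_ge_atTop _
  filter_upwards [hmom, hlarge, eventually_gt_atTop 0] with N hmomN hlargeN hN0
  have hNr : (0 : ℝ) < N := by exact_mod_cast hN0
  rw [Real.dist_0_eq_abs, abs_div, abs_of_pos hNr, div_lt_iff₀ hNr]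
  -- notation
  set A : ℝ := ∑ n ∈ range N, (μ n : ℝ) * u n with hA
  set W : ℕ → ℝ := fun i => ∑ j ∈ range m, (μ (i + j) : ℝ) * u (i + j) with hW
  set Bad : ℕ → Prop := fun i => ∃ c ∈ P, ε * m < |∑ j ∈ range m, c j * (μ (i + j) : ℝ)|
    with hBad
  -- (B) double counting
  have hB : |(m : ℝ) * A - ∑ i ∈ range N, W i| ≤ 2 * (m : ℝ) ^ 2 :=
    abs_mul_sum_sub_sum_window_le (fun n => (μ n : ℝ) * u n)
      (fun n => by
        rw [abs_mul]
        exact mul_le_one₀ (mod_cast ArithmeticFunction.abs_moebius_le_one) (abs_nonneg _) (hu n)) m N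
  -- (A) windows: good ones are small, bad ones are at most `m`
  have hAi : ∀ i, |W i| ≤ 2 * ε * m + m * (if Bad i then 1 else 0) := by
    intro i
    obtain ⟨c, hcP, hci⟩ := hcov i
    have h1 := abs_windowSum_le_of_approx u c m i hci
    by_cases hb : Bad i
    · rw [if_pos hb, mul_one]
      have h2 := abs_windowSum_le_length u hu m i
      have h3 : (0 : ℝ) ≤ 2 * ε * m := by positivity
      exact h2.trans (by linarith)
    · rw [if_neg hb, mul_zero, add_zero]
      have h2 : |∑ j ∈ range m, c j * (μ (i + j) : ℝ)| ≤ ε * m := by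
        by_contra hlt
        exact hb ⟨c, hcP, not_le.1 hlt⟩
      exact h1.trans (by linarith)
  -- (C) Markov + union bound: few bad windows
  have hCnt : (#{i ∈ range N | Bad i} : ℝ)
      ≤ ∑ c ∈ P, (∑ i ∈ range N, (∑ j ∈ range m, c j * (μ (i + j) : ℝ)) ^ (2 * p))
          / (ε * m) ^ (2 * p) :=
    card_filter_le_sum_moment_div P (fun c i => ∑ j ∈ range m, c j * (μ (i + j) : ℝ)) N p
      (by positivity) Bad (fun i hi => hi)
  have hCnt2 : (#{i ∈ range N | Bad i} : ℝ) ≤ ε * N := by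
    refine hCnt.trans ?_
    calc ∑ c ∈ P, (∑ i ∈ range N, (∑ j ∈ range m, c j * (μ (i + j) : ℝ)) ^ (2 * p))
            / (ε * m) ^ (2 * p)
          ≤ ∑ c ∈ P, (((m : ℝ) ^ p * (((2 * p)! : ℝ) / p !) + 1) * N) / (ε * m) ^ (2 * p) := by
            refine sum_le_sum fun c hcP => ?_
            exact div_le_div_of_nonneg_right (hmomN c hcP) (by positivity)
      _ = (#P : ℝ) * ((m : ℝ) ^ p * (((2 * p)! : ℝ) / p !) + 1) / (ε * m) ^ (2 * p) * N := by
            rw [sum_const, nsmul_eq_mul]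
            ring
      _ ≤ ε * N := mul_le_mul_of_nonneg_right hnum hNr.le
  -- sum of (A) over the windows
  have hsumW : ∑ i ∈ range N, |W i| ≤ 2 * ε * m * N + m * (ε * N) := by
    calc ∑ i ∈ range N, |W i|
          ≤ ∑ i ∈ range N, (2 * ε * m + m * (if Bad i then 1 else 0)) := sum_le_sum fun i _ => hAi i
      _ = 2 * ε * m * N + m * #{i ∈ range N | Bad i} := by
            rw [sum_add_distrib, sum_const, card_range, nsmul_eq_mul, ← mul_sum, sum_boole]
            ring
      _ ≤ 2 * ε * m * N + m * (ε * N) := by gcongr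
  -- combine
  have hsumW' : |∑ i ∈ range N, W i| ≤ 2 * ε * m * N + m * (ε * N) :=
    (abs_sum_le_sum_abs _ _).trans hsumW
  have hmA : (m : ℝ) * |A| ≤ 2 * ε * m * N + m * (ε * N) + 2 * (m : ℝ) ^ 2 := by
    have h1 := abs_sub_abs_le_abs_sub ((m : ℝ) * A) (∑ i ∈ range N, W i)
    rw [abs_mul, abs_of_pos hmr] at h1
    linarith
  have hA3 : |A| ≤ 3 * ε * N + 2 * m := by
    have h2 : (m : ℝ) * |A| ≤ m * (3 * ε * N + 2 * m) := by nlinarith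
    exact le_of_mul_le_mul_left h2 hmr
  calc |A| ≤ 3 * ε * N + 2 * m := hA3
    _ ≤ 3 * ε * N + ε * N := by linarith
    _ = 4 * ε * N := by ring
    _ < ε₀ * N := by
        have : 4 * ε < ε₀ := by linarith
        exact mul_lt_mul_of_pos_right this hNr


/-! ### Zero topological entropy gives subexponentially many patterns -/

/-- **Zero entropy ⇒ few patterns.** If `T` has zero topological (cover) entropy on a compact
metric space, `g` is continuous with `|g| ≤ 1`, then for all `ε, η > 0` and arbitrarily
large `m` the windows `(g(T^{i+j} x))_{j<m}`, `i ∈ ℕ`, are `ε`-approximated in sup norm by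
at most `e^{η m}` patterns: take a minimal `(U, m)`-dynamical cover for the entourage
`U = {d < δ}` given by uniform continuity of `g`; its cardinality is `coverMincard`, whose
exponential growth rate `coverEntropyEntourage ≤ coverEntropy = 0`.
(Bowen–Dinaburg; Mathlib `Dynamics.coverEntropy`.) [folklore] -/
theorem exists_patternCover_of_coverEntropy_eq_zero {X : Type*} [MetricSpace X] [CompactSpace X]
    {T : X → X} (hT : Continuous T) (h0 : Dynamics.coverEntropy T Set.univ = 0)
    {g : X → ℝ} (hg : Continuous g) (hg1 : ∀ y, |g y| ≤ 1) (x : X)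
    {ε : ℝ} (hε : 0 < ε) {η : ℝ} (hη : 0 < η) (m₀ : ℕ) :
    ∃ m : ℕ, m₀ ≤ m ∧ ∃ P : Finset (ℕ → ℝ), (#P : ℝ) ≤ Real.exp (η * m) ∧
      (∀ c ∈ P, ∀ j, |c j| ≤ 1) ∧ ∀ i : ℕ, ∃ c ∈ P, ∀ j < m, |g (T^[i + j] x) - c j| ≤ ε := by
  classical
  obtain ⟨δ, hδ, hδε⟩ :=
    Metric.uniformContinuous_iff.1 (CompactSpace.uniformContinuous_of_continuous hg) ε hε
  set U : SetRel X X := {q : X × X | dist q.1 q.2 < δ} with hU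
  have hUmem : U ∈ uniformity X := Metric.dist_mem_uniformity hδ
  have hle : Dynamics.coverEntropyEntourage T Set.univ U ≤ 0 :=
    h0 ▸ Dynamics.coverEntropyEntourage_le_coverEntropy T Set.univ hUmem
  have hlt : Dynamics.coverEntropyEntourage T Set.univ U < (η : EReal) :=
    hle.trans_lt (by exact_mod_cast hη)
  have hev : ∀ᶠ n : ℕ in atTop,
      ((Dynamics.coverMincard T Set.univ U n : ℕ∞) : ENNReal) ≤ EReal.exp (η * n) :=
    ExpGrowth.eventually_le_exp hlt
  obtain ⟨m, hmev, hm⟩ := (hev.and (eventually_ge_atTop m₀)).exists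
  have hTu : UniformContinuous T := CompactSpace.uniformContinuous_of_continuous hT
  have hfin := Dynamics.coverMincard_finite_of_isCompact_uniformContinuous isCompact_univ hTu hUmem m
  obtain ⟨s, hs, hscard⟩ := (Dynamics.coverMincard_finite_iff T Set.univ U m).1 hfin
  refine ⟨m, hm, s.image (fun y => fun j => g (T^[j] y)), ?_, ?_, ?_⟩
  · calc (#(s.image (fun y => fun j => g (T^[j] y))) : ℝ) ≤ #s := by exact_mod_cast card_image_le
      _ ≤ Real.exp (η * m) := by
        rw [← hscard, ENat.toENNReal_coe] at hmev
        have h1 : (η : EReal) * (m : EReal) = ((η * m : ℝ) : EReal) := by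
          rw [EReal.coe_mul, EReal.coe_coe_eq_natCast]
        have h2 : (#s : ENNReal) = ENNReal.ofReal (#s : ℝ) := (ENNReal.ofReal_natCast _).symm
        rw [h1, EReal.exp_coe, h2, ENNReal.ofReal_le_ofReal_iff (Real.exp_pos _).le] at hmev
        exact hmev
  · intro c hc j
    obtain ⟨y, -, rfl⟩ := mem_image.1 hc
    exact hg1 _
  · intro i
    obtain ⟨y, hy, hxy⟩ := hs (Set.mem_univ (T^[i] x))
    refine ⟨fun j => g (T^[j] y), mem_image_of_mem _ (by simpa using hy), fun j hj => ?_⟩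
    have h1 := Dynamics.mem_dynEntourage.1 hxy j hj
    have hdist : dist (T^[j] (T^[i] x)) (T^[j] y) < δ := h1
    have h2 : T^[j] (T^[i] x) = T^[i + j] x := by
      rw [add_comm, Function.iterate_add_apply]
    rw [h2] at hdist
    have h3 := hδε hdist
    rw [Real.dist_eq] at h3
    exact h3.le

end SarnakOfChowla

open SarnakOfChowla in
/-- **parity.S23, discharged: Chowla (Möbius sign-pattern form) implies Sarnak's Möbius
disjointness conjecture.** Sarnak, *Three lectures on the Möbius function, randomness and
dynamics* (IAS, 2010), §3; printed as Theorem 4.10 "(Ch) implies (S)" of El Abdalaoui–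
Kułaga-Przymus–Lemańczyk–de la Rue, Discrete Contin. Dyn. Syst. 37 (2017) (dynamical proof,
§4.3); the elementary proof formalised here is Tao's (*The Chowla conjecture and the Sarnak
conjecture*, What's new, 14 Oct 2012).
Proof: split `f` into real and imaginary parts and normalise to `|g| ≤ 1`; zero topological
entropy gives `e^{o(m)}` patterns for the windows of `g(Tⁿx)`
(`exists_patternCover_of_coverEntropy_eq_zero`), and the moment method under Chowla
(`tendsto_moebius_avg_of_patternCover`) gives `(1/N) ∑_{n<N} μ(n) g(Tⁿ x) → 0`.
[cite: AbdalaouiEtAl2017, Theorem 4.10] -/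
theorem sarnakConjecture_of_moebiusChowlaConjecture_holds :
    sarnakConjecture_of_moebiusChowlaConjecture := by
  intro hC X _ _ T hT h0 f x
  set B : ℝ := ‖f‖ + 1 with hB
  have hB0 : 0 < B := by positivity
  have hfB : ∀ y, ‖f y‖ ≤ B := fun y => (f.norm_coe_le_norm y).trans (by linarith)
  set g₁ : X → ℝ := fun y => (f y).re / B with hg₁
  set g₂ : X → ℝ := fun y => (f y).im / B with hg₂
  have hg₁c : Continuous g₁ := (Complex.continuous_re.comp f.continuous).div_const _
  have hg₂c : Continuous g₂ := (Complex.continuous_im.comp f.continuous).div_const _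
  have hg₁b : ∀ y, |g₁ y| ≤ 1 := fun y => by
    simp only [hg₁]
    rw [abs_div, abs_of_pos hB0, div_le_one hB0]
    exact (Complex.abs_re_le_norm _).trans (hfB y)
  have hg₂b : ∀ y, |g₂ y| ≤ 1 := fun y => by
    simp only [hg₂]
    rw [abs_div, abs_of_pos hB0, div_le_one hB0]
    exact (Complex.abs_im_le_norm _).trans (hfB y)
  have h₁ := tendsto_moebius_avg_of_patternCover hC (fun n => g₁ (T^[n] x)) (fun n => hg₁b _)
    (fun ε hε η hη m₀ => exists_patternCover_of_coverEntropy_eq_zero hT h0 hg₁c hg₁b x hε hη m₀)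
  have h₂ := tendsto_moebius_avg_of_patternCover hC (fun n => g₂ (T^[n] x)) (fun n => hg₂b _)
    (fun ε hε η hη m₀ => exists_patternCover_of_coverEntropy_eq_zero hT h0 hg₂c hg₂b x hε hη m₀)
  have hlim := ((h₁.ofReal).add ((h₂.ofReal).mul_const Complex.I)).const_mul (B : ℂ)
  simp only [Complex.ofReal_zero, zero_mul, add_zero, mul_zero] at hlim
  have hf : ∀ y, f y = (B : ℂ) * ((g₁ y : ℂ) + (g₂ y : ℂ) * Complex.I) := by
    intro y
    have hBne : (B : ℂ) ≠ 0 := by exact_mod_cast hB0.ne'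
    simp only [hg₁, hg₂, Complex.ofReal_div]
    calc f y = ((f y).re : ℂ) + ((f y).im : ℂ) * Complex.I := (Complex.re_add_im _).symm
      _ = _ := by field_simp
  refine hlim.congr fun N => ?_
  have hS : ∑ n ∈ range N, (μ n : ℂ) * ((g₁ (T^[n] x) : ℂ) + (g₂ (T^[n] x) : ℂ) * Complex.I)
      = ∑ n ∈ range N, (μ n : ℂ) * (g₁ (T^[n] x) : ℂ)
        + (∑ n ∈ range N, (μ n : ℂ) * (g₂ (T^[n] x) : ℂ)) * Complex.I := by
    rw [sum_mul, ← sum_add_distrib]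
    exact sum_congr rfl fun n _ => by ring
  have hR : (N : ℂ)⁻¹ * ∑ n ∈ range N, (μ n : ℂ) * f (T^[n] x)
      = (B : ℂ) * ((N : ℂ)⁻¹ * ∑ n ∈ range N,
          (μ n : ℂ) * ((g₁ (T^[n] x) : ℂ) + (g₂ (T^[n] x) : ℂ) * Complex.I)) := by
    rw [mul_sum, mul_sum, mul_sum]
    exact sum_congr rfl fun n _ => by rw [hf]; ring
  rw [hR, hS]
  push_cast
  ring

end Literature.NumberTheory.Sieve
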